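import Summits.KontsevichZagierPeriods.KontsevichZagierPeriods.Theses.AttractorUnfolding
import Summits.KontsevichZagierPeriods.KontsevichZagierPeriods.Theorems.InverseLandauTateLiftingTubeIsTwist

/-!
# `TubeIsTwist` (stmt-KontsevichZagierPeriods-14422, route AttractorUnfolding) — proof

The item says: for every operation `P` pinned by the two literal field equations of "disc × ρ"
(domain `{z | z₀² + z₁² ≤ 1 ∧ (z₂, …) ∈ σ}`, integrand `f(z₂, …)`) and every representation `r'`
with domain `{z | init z ∈ σ}` and integrand `f(init z)/(1 + z_last²)` on it,
`[r'] − [P n ρ] ∈ KZ.relations` — multiplying by `π` as `∫_ℝ dt/(1+t²)` or as the unit disc is the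
same modulo Kontsevich–Zagier's rules, uniformly in the other factor. It is, verbatim, the theorem
`Summit.KontsevichZagierPeriods.InverseLandau.tateLifting_tubeIsTwist` (line `Sketch` of crux
`TateLifting`, stmt-KontsevichZagierPeriods-9129, lead c10), proved in the formal period ring:
`r' ∼ ρ × [ℝ, 1/(1+t²)] ∼ ρ × [disc] ∼ [disc] × ρ ∼ relabelled ∼ P n ρ`.
-/

namespace Summit.KontsevichZagierPeriods.AttractorUnfolding

/-- **`TubeIsTwist`** (route AttractorUnfolding, stmt-KontsevichZagierPeriods-14422):
`[σ × ℝ, f(x)/(1+t²)] − [D̄ × σ, f] ∈ KZ.relations` for every pinned "disc × ρ" operation `P`.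
Proof: `InverseLandau.tateLifting_tubeIsTwist`. [cite: KontsevichZagier2001, §1.2] -/
theorem tubeIsTwist_proof :
    Summit.KontsevichZagierPeriods.KontsevichZagierPeriods.Theses.AttractorUnfolding.TubeIsTwist :=
  Summit.KontsevichZagierPeriods.InverseLandau.tateLifting_tubeIsTwist

end Summit.KontsevichZagierPeriods.AttractorUnfolding
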